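import Summits.BirchSwinnertonDyer.BirchSwinnertonDyer.Theorems.Rank2ObservatoryTateStep2Cert
import Summits.BirchSwinnertonDyer.BirchSwinnertonDyer.Theorems.Rank2ObservatoryRank3MinimalCensus
import Literature.NumberTheory.DiophantineGeometry.ConductorExponentZeroProofs
import Literature.NumberTheory.DiophantineGeometry.ConductorMultiplicativeProofs
import Literature.NumberTheory.DiophantineGeometry.ConductorAdditiveProofs
import Literature.NumberTheory.DiophantineGeometry.ConductorExponentLeTwoProofs
import Literature.NumberTheory.DiophantineGeometry.ConductorFactorizationProofs
import HarnessLib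

/-!
# Rank-2 observatory (b2b-bsdr2, cert-2 gen 6): the conductor of an integer equation ADDITIVE AT `2`
# from a root-number certificate and a Tate certificate at `2` — `N_E = 2^{f₂} · ∏ p^{f_p}` with NO named fact

HONEST FRAMING: per-curve certified theorems and census instruments; no claim on BSD in rank ≥ 2.

The gen-5/6 conductor certificates (`Rank2ObservatoryConductorCert`, `…ConductorCert3`,
`…Rank3ConductorFinal`) prove `conductorNorm ℤ E = N` only for equations TAME AT `2` (`2 ∤ Δ` or
`2 ∤ c₄`): the `3024` rank-3 census rows additive at `2` kept `hN` as a hypothesis.  This file removes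
it whenever a TATE CERTIFICATE at `2` is available (`Rank2ObservatoryTateStep2Cert`: Steps 1–5 of
Tate's algorithm, Kodaira types `II`, `III`, `IV`, `f₂ = v₂(Δ) + 1 − m` by Ogg's formula — the tree's
DEFINITION of `conductorExponent` — with the algorithm's forward evaluations PROVED in the tree):

* `conductorExponent_eq_of_check_odd` — at every ODD place the conductor exponent is the one the
  gen-5 certificate lists (`0` off the bad primes, `1` multiplicative, `2` additive with `p ≥ 5`),
  with the conductor-exponent facts `h0 h1 h2 h5` DISCHARGED by the tree theorems
  `conductorExponent_eq_zero_iff_holds`, `…_eq_one_iff_holds`, `two_le_conductorExponent_iff_holds`,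
  `conductorExponent_le_two_of_five_le_natGenerator_holds`, and NO tameness hypothesis;
* `RNCert.conductorStep2 c f₂ = 2^{f₂} · ∏ p^{condExp}` and
  **`conductorNorm_eq_conductorStep2 : c.check W₀ → tc.p = 2 → tc.check W₀ →
  conductorNorm ℤ (W₀ ⊗ ℚ) = c.conductorStep2 tc.f`** — NO named fact (`hf` discharged by
  `factorization_conductorNorm_holds`);
* the census instrument for gen 7: the one-pass position-indexed walk `step2Walk` over
  `rank3Table.zip rank3RNCerts` and `Rank3Row.conductorNorm_eq_of_step2Walk` — every pair
  `(row index, Tate certificate)` of a list passing the walk has `conductorNorm ℤ E_row = N_row`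
  (data chunks with their kernel theorems are all that remains to be filed);
* hypothesis-free self-tests: `N(26284a1) = 26284 = 2²·6571` (type `IV` at `2`),
  `N(55064b1)`-style checks are in `Rank2ObservatoryTateStep2Cert`.

Engine agreement outside the proofs (unit folder, `tate_step2.py` vs PARI `elllocalred`, job
`j101307`): Kodaira type and `f₂` agree on all `872` rank-3 census rows of type `II/III/IV` at `2`
(`749` of them tame at `3`, i.e. with a gen-5 certificate) and `f₃` on all `540` of type `II/III/IV`
at `3`; `2^{f₂} ∥ N` on all `872`.

References: J. H. Silverman, *Advanced Topics in the Arithmetic of Elliptic Curves*, GTM 151 (1994),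
IV.9.4 (Tate's algorithm), IV.10.2, IV.10.4, IV.11.1 (Ogg's formula) [Silverman1994]; J. H. Silverman,
*The Arithmetic of Elliptic Curves*, 2nd ed. (2009), VII.5.1, C.16 [SilvermanAEC2009]; J. E. Cremona,
*Algorithms for Modular Elliptic Curves*, 2nd ed. (1997), §3.2 and Tables [CremonaAlgorithms1997].
-/

open IsDedekindDomain Rat.HeightOneSpectrum WeierstrassCurve Literature
  Literature.NumberTheory.EllipticCurves

namespace Summit.BirchSwinnertonDyer.BirchSwinnertonDyer.Rank2Observatory.RootNumber

open Tate

section IntModel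

variable {W₀ : WeierstrassCurve ℤ} {c : RNCert}

/-- The certified conductor with the exponent at `2` SUPPLIED (by a Tate certificate):
`2^{f₂} · ∏ p ^ condExp`. [cite: Silverman1994, IV.10.2] -/
def RNCert.conductorStep2 (c : RNCert) (f₂ : ℕ) : ℕ :=
  2 ^ f₂ * (c.odd.map fun E => E.p ^ E.condExp).prod

/-- The odd part of the certified conductor is non-zero. [folklore] -/
theorem prod_condExp_ne_zero (hc : c.check W₀ = true) :
    (c.odd.map fun E => E.p ^ E.condExp).prod ≠ 0 := by
  obtain ⟨-, -, -, -, hall, -⟩ := RNCert.check_spec hc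
  rw [Ne, List.prod_eq_zero_iff, List.mem_map]
  rintro ⟨E, hE, h0⟩
  exact pow_ne_zero _ (OddEntry.check_spec (hall E hE)).1.ne_zero h0

/-- **The conductor exponent at an ODD place, from the certificate, NO tameness hypothesis and NO
named fact**: `f_v` is `0` off the bad primes, `condExp` at a listed odd prime (the four
conductor-exponent facts are the tree's theorems). [cite: Silverman1994, IV.10.2 and IV.10.4] -/
theorem conductorExponent_eq_of_check_odd (hc : c.check W₀ = true) (v : HeightOneSpectrum ℤ)
    (hv2 : natGenerator v ≠ 2) :
    (W₀.baseChange ℚ).conductorExponent v =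
      (c.odd.map fun E => if E.p = natGenerator v then E.condExp else 0).sum := by
  haveI := isElliptic_of_check hc
  obtain ⟨-, -, -, hnd, hall, -⟩ := RNCert.check_spec hc
  have e0 : (W₀.baseChange ℚ).conductorExponent v = 0 ↔ (W₀.baseChange ℚ).HasGoodReductionAt v :=
    conductorExponent_eq_zero_iff_holds v _
  have e1 : (W₀.baseChange ℚ).conductorExponent v = 1 ↔
      (W₀.baseChange ℚ).HasMultiplicativeReductionAt v := conductorExponent_eq_one_iff_holds v _
  have e2 : 2 ≤ (W₀.baseChange ℚ).conductorExponent v ↔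
      (W₀.baseChange ℚ).HasAdditiveReductionAt v := two_le_conductorExponent_iff_holds v _
  have e5 : 5 ≤ natGenerator v → (W₀.baseChange ℚ).conductorExponent v ≤ 2 :=
    conductorExponent_le_two_of_five_le_natGenerator_holds _ v
  have hp : (natGenerator v).Prime := prime_natGenerator v
  by_cases hmem : natGenerator v ∈ c.odd.map OddEntry.p
  · -- a listed odd prime
    obtain ⟨E, hE, hEp⟩ := List.mem_map.mp hmem
    rw [← hEp, sum_ite_eq_of_nodup _ _ hnd E hE]
    obtain ⟨-, -, he, hk0, hk1, hk2'⟩ := OddEntry.check_spec (hall E hE)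
    have hΔ : (natGenerator v : ℤ) ∣ W₀.Δ := hEp ▸ dvd_Δ_of_mem hc hE
    by_cases hK0 : E.kind = 0
    · rw [OddEntry.condExp, if_pos hK0]
      exact e1.mpr (hasMultiplicativeReductionAt_of_dvd_of_not_dvd hΔ (hEp ▸ (hk0 hK0).1))
    by_cases hK1 : E.kind = 1
    · rw [OddEntry.condExp, if_neg hK0, if_pos hK1]
      exact e1.mpr (hasMultiplicativeReductionAt_of_dvd_of_not_dvd hΔ (hEp ▸ (hk1 hK1).1))
    · rw [OddEntry.condExp, if_neg hK0, if_neg hK1]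
      obtain ⟨h5p, heΔ, hc₄, htc, hmin⟩ := hk2' hK0 hK1
      refine le_antisymm (e5 (hEp ▸ h5p)) (e2.mpr ?_)
      refine hasAdditiveReductionAt_of_dvd v he (hEp ▸ (exactPow_spec heΔ).1)
        (hEp ▸ (exactPow_spec heΔ).2) ?_ (hEp ▸ hc₄)
      rcases hmin with h | h
      · exact Or.inl h
      · right
        rw [← hEp]
        exact fun h4 ↦ (exactPow_spec htc).2 (dvd_trans (pow_dvd_pow _ (by omega)) h4)
  · -- off the bad primes: good reduction
    rw [sum_ite_eq_zero _ _ _ fun E hE h ↦ hmem (List.mem_map.mpr ⟨E, hE, h⟩)]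
    refine e0.mpr (hasGoodReductionAt_of_not_dvd fun hdvd ↦ ?_)
    rcases List.mem_cons.mp (mem_of_prime_dvd hc hp hdvd) with h | h
    · exact hv2 h
    · exact hmem h

/-- **The conductor from a root-number certificate and a Tate certificate at `2`** — NO named fact:
`N (W₀ ⊗ ℚ) = 2^{f₂} · ∏ p^{condExp}` with `f₂` the Tate certificate's `v₂(Δ) + 1 − m`.
[cite: Silverman1994, IV.10.2, IV.10.4 and IV.11.1] [cite: SilvermanAEC2009, C.16] -/
theorem conductorNorm_eq_conductorStep2 (hc : c.check W₀ = true) {tc : Step2Cert} (htp : tc.p = 2)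
    (htc : tc.check W₀ = true) : (W₀.baseChange ℚ).conductorNorm ℤ = c.conductorStep2 tc.f := by
  haveI := isElliptic_of_check hc
  obtain ⟨-, -, -, -, hall, -⟩ := RNCert.check_spec hc
  have hprime : ∀ E ∈ c.odd, E.p.Prime := fun E hE ↦ (OddEntry.check_spec (hall E hE)).1
  have hne := prod_condExp_ne_zero hc
  refine Nat.eq_of_factorization_eq
    (conductorNorm_pos_holds (W₀.baseChange ℚ) : 0 < (W₀.baseChange ℚ).conductorNorm ℤ).ne'
    (mul_ne_zero (pow_ne_zero _ two_ne_zero) hne) fun p ↦ ?_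
  by_cases hp : p.Prime
  · have hfac : ((W₀.baseChange ℚ).conductorNorm ℤ).factorization (natGenerator (natPlace p)) =
        (W₀.baseChange ℚ).conductorExponent (natPlace p) := factorization_conductorNorm_holds _ _
    rw [natGenerator_natPlace hp] at hfac
    rw [hfac, RNCert.conductorStep2, Nat.factorization_mul (pow_ne_zero _ two_ne_zero) hne,
      Finsupp.add_apply, factorization_prod_map_pow OddEntry.condExp c.odd hprime p,
      Nat.factorization_pow, Finsupp.smul_apply, smul_eq_mul, Nat.prime_two.factorization,
      Finsupp.single_apply]
    by_cases hp2 : p = 2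
    · subst hp2
      rw [if_pos rfl, mul_one, sum_ite_eq_zero _ _ _ fun E hE ↦ (OddEntry.check_spec (hall E hE)).2.1,
        add_zero]
      exact Step2Cert.conductorExponent_int_eq (natPlace 2)
        ((natGenerator_natPlace hp).trans htp.symm) htc
    · rw [if_neg (Ne.symm hp2), mul_zero, zero_add,
        conductorExponent_eq_of_check_odd hc (natPlace p) (by rwa [natGenerator_natPlace hp]),
        natGenerator_natPlace hp]
  · rw [Nat.factorization_eq_zero_of_not_prime _ hp, Nat.factorization_eq_zero_of_not_prime _ hp]

end IntModel

/-- Self-test (kernel): the gen-5 certificate of `26284a1 = [0,1,0,-9,16]` checks, and with `f₂ = 2`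
its conductor is `26284 = 2²·6571`. [cite: CremonaAlgorithms1997, Tables] -/
theorem conductorStep2_26284a1 :
    RNCert.check ⟨0, 1, 0, -9, 16⟩ ⟨4, 6, 5, [⟨6571, 81, 1, 1, 5656⟩]⟩ = true ∧
      RNCert.conductorStep2 ⟨4, 6, 5, [⟨6571, 81, 1, 1, 5656⟩]⟩ 2 = 26284 := by
  decide +kernel

/-- **`N(26284a1) = 26284`, hypothesis-free** — an equation ADDITIVE at `2` (Kodaira type `IV`,
`f₂ = 2` by the Tate certificate `(r,s,t) = (1,0,1)`), out of reach of the tame certificates.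
[cite: CremonaAlgorithms1997, Tables] [cite: Silverman1994, IV.11.1] -/
theorem conductorNorm_26284a1 :
    ((⟨0, 1, 0, -9, 16⟩ : WeierstrassCurve ℤ).baseChange ℚ).conductorNorm ℤ = 26284 :=
  (conductorNorm_eq_conductorStep2 conductorStep2_26284a1.1 (tc := ⟨2, 1, 0, 1, 4, 4, 2⟩) rfl
    check_26284a1).trans conductorStep2_26284a1.2

end Summit.BirchSwinnertonDyer.BirchSwinnertonDyer.Rank2Observatory.RootNumber

/-! ### The census instrument: a one-pass walk over the rank-3 table with its gen-5 certificates -/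

namespace Summit.BirchSwinnertonDyer.BirchSwinnertonDyer.Rank2Observatory

open RootNumber Tate

/-- The per-row check of a Tate certificate at `2` against a census row WITH a gen-5 certificate:
`p = 2`, the Tate certificate checks on the row's integer model, and the certified conductor
`2^{f₂} · ∏ p^{condExp}` is the table's `N`. [folklore] -/
def step2Entry (rc : Rank3Row × Option RNCert) (tc : Step2Cert) : Bool :=
  match rc.2 with
  | none => false
  | some c => decide (tc.p = 2) && tc.check rc.1.intModel && decide (c.conductorStep2 tc.f = rc.1.N)

/-- One-pass position-indexed walk: the pairs `(i, tc)` (indices increasing) are checked against the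
`i`-th entry of the zipped table. [folklore] -/
def step2Walk : List (Rank3Row × Option RNCert) → ℕ → List (ℕ × Step2Cert) → Bool
  | _, _, [] => true
  | [], _, _ :: _ => false
  | rc :: rs, n, (i, tc) :: rest =>
      if i = n then step2Entry rc tc && step2Walk rs (n + 1) rest
      else step2Walk rs (n + 1) ((i, tc) :: rest)

/-- What a passing walk says about each listed pair. [folklore] -/
theorem entry_of_step2Walk :
    ∀ (rows : List (Rank3Row × Option RNCert)) (n : ℕ) (ps : List (ℕ × Step2Cert)),
      step2Walk rows n ps = true → ∀ (i : ℕ) (tc : Step2Cert), (i, tc) ∈ ps →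
        n ≤ i ∧ ∃ rc : Rank3Row × Option RNCert, rows[i - n]? = some rc ∧ step2Entry rc tc = true
  | _, _, [], _, i, tc, hm => by simp at hm
  | [], _, _ :: _, h, _, _, _ => by simp [step2Walk] at h
  | rc :: rs, n, (j, d) :: rest, h, i, tc, hm => by
    by_cases hj : j = n
    · subst hj
      simp only [step2Walk, ↓reduceIte, Bool.and_eq_true] at h
      rcases List.mem_cons.mp hm with he | hm'
      · obtain ⟨rfl, rfl⟩ := Prod.mk.inj he
        exact ⟨le_rfl, rc, by simp, h.1⟩
      · obtain ⟨hle, rc', hr', he'⟩ := entry_of_step2Walk rs (j + 1) rest h.2 i tc hm'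
        refine ⟨by omega, rc', ?_, he'⟩
        rw [show i - j = (i - (j + 1)) + 1 by omega, List.getElem?_cons_succ]
        exact hr'
    · simp only [step2Walk, hj, ↓reduceIte] at h
      obtain ⟨hle, rc', hr', he'⟩ := entry_of_step2Walk rs (n + 1) ((j, d) :: rest) h i tc hm
      refine ⟨by omega, rc', ?_, he'⟩
      rw [show i - n = (i - (n + 1)) + 1 by omega, List.getElem?_cons_succ]
      exact hr'

/-- **`N_E = N` for every census row listed in a Tate-certificate list passing the walk** — NO named
fact, NO hypothesis beyond the kernel check of the list. [cite: Silverman1994, IV.10.2 and IV.11.1]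
[cite: CremonaAlgorithms1997, Tables] -/
theorem Rank3Row.conductorNorm_eq_of_step2Walk {ps : List (ℕ × Step2Cert)}
    (h : step2Walk (rank3Table.zip rank3RNCerts) 0 ps = true) {i : ℕ} {tc : Step2Cert}
    (hm : (i, tc) ∈ ps) :
    ∃ hi : i < rank3Table.length, (rank3Table[i]'hi).curve.conductorNorm ℤ = (rank3Table[i]'hi).N := by
  obtain ⟨-, ⟨r, oc⟩, hrc, he⟩ := entry_of_step2Walk _ 0 ps h i tc hm
  rw [Nat.sub_zero] at hrc
  obtain ⟨hr, hoc⟩ := List.getElem?_zip_eq_some.mp hrc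
  obtain ⟨hi, rfl⟩ := List.getElem?_eq_some_iff.mp hr
  cases oc with
  | none => simp [step2Entry] at he
  | some c =>
    simp only [step2Entry, Bool.and_eq_true, decide_eq_true_eq] at he
    obtain ⟨⟨htp, htc⟩, hN⟩ := he
    have hc : c.check (rank3Table[i]'hi).intModel = true :=
      check_of_rnRowsCheck _ _ rank3Table_rnCheck i hi c hoc
    exact ⟨hi, by rw [Rank3Row.curve_eq_baseChange, conductorNorm_eq_conductorStep2 hc htp htc, hN]⟩

/-- Self-test of the walk (kernel): row `23` of the census is `26284a1` and its Tate certificate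
passes the per-row check against the gen-5 certificate. [cite: CremonaAlgorithms1997, Tables] -/
theorem step2Walk_row23 : step2Walk (rank3Table.zip rank3RNCerts) 0 [(23, ⟨2, 1, 0, 1, 4, 4, 2⟩)] = true := by
  decide +kernel

/-- Hence `N(E₂₃) = N₂₃ (= 26284)` for census row `23`, hypothesis-free, through the census
instrument. [cite: CremonaAlgorithms1997, Tables] -/
theorem conductorNorm_row23 :
    ∃ hi : 23 < rank3Table.length, (rank3Table[23]'hi).curve.conductorNorm ℤ = (rank3Table[23]'hi).N :=
  Rank3Row.conductorNorm_eq_of_step2Walk step2Walk_row23 (List.mem_singleton.mpr rfl)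

end Summit.BirchSwinnertonDyer.BirchSwinnertonDyer.Rank2Observatory
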